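import Literature.MathematicalPhysics.QuantumFieldTheory.Balaban1983to89.B8Prop5Reality

/-!
# `Balaban1983to89.B8Prop5TraceFree` — [Balaban1985RegularSpaces] Sect. D pp. 93–94: THE SOLUTION OF (1.100) IS `𝔤`-VALUED — for every
# continuous TRACIAL functional `τ` (with the additivity of `τ ∘ log` on products of small exponentials) the fixed point of Proposition 5's
# contraction is `τ`-FREE (`τ(λ(x)) = 0` at every site) as soon as the datum and the letters are: the special-unitary (traceless) closure
# of Proposition 5, the kernel form of joint J-SU of sub-row «G-B8-T2S»

statement-level skeleton of published theorems with citation tags; proofs where landed; nothing here is a claim about the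
Yang–Mills mass gap

T. Bałaban, *Spaces of regular gauge field configurations on a lattice and gauge fixing conditions*, Commun. Math. Phys. **99** (1985)
75–102 `[Balaban1985RegularSpaces]` ("B8"; printed page = PDF page + 74): Sect. D (1.86)–(1.103) pp. 91–93, Proposition 5 (1.106)–(1.109)
p. 94; the gauge group `G` and its Lie algebra `𝔤` p. 76 («functions defined at sites of the lattice T₁, with values in G»; «λ … with values in
the algebra 𝔤 of G» (1.17) p. 78).  [3] = [Balaban1985Averaging] (21)–(23), (28)–(33) pp. 21–23.  STATUS: published, refereed.

CITATION HEADER (lean-in-tree rule).  Cell `lit-balaban`, seat `lit-balaban-t2s-1` (gen 0), sub-row «G-B8-T2S» = the [B8] §3 THEOREM 2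
TORUS SUPPLIER for R3 `stmt-QuantumFields-19200`, JOINT J-SU (lead g29 2026-08-28T00:11:16Z (3): «ONE abstract lemma "unique FP of a contraction
mapping B ∩ S into closed S lies in S" … the contraction then preserves 𝔰-valued λ … the exit is det (exp λ_b) = exp (tr λ_b) = 1»; JOINT RULING #2
(R2): the consumer is hard-typed `Matrix.specialUnitaryGroup (Fin 2) ℂ`).  WHAT IS REPRODUCED.  Print works with `𝔤`-valued gauge parameters
throughout (p. 76, (1.17) p. 78) and complexifies `λ` only as a device (p. 93: «we consider configurations λ with values in the complexified
algebra»).  The tree types Sect. D in a general C⋆-algebra `𝔸` and recovers REALITY of the fixed point by invariance (`B8Prop5Reality`: the Hermitian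
configurations are a closed set containing `0`, mapped into itself by the contraction; r05's `B8SectDSource.fixedPoint_mem_of_invariant`).  THIS FILE
runs the SAME invariance argument for the KERNEL OF A TRACIAL FUNCTIONAL `τ : 𝔸 →L[ℂ] ℂ` — the abstract form of «traceless» (`𝔸 = M_N(ℂ)`,
`τ = tr`: `𝔰𝔲(N) = {X Hermitian ∣ tr X = 0}`): under (T1) `τ(xy) = τ(yx)` and (T2) `τ(log(eᵃeᵇ)) = τ(a) + τ(b)` for `‖a‖ + ‖b‖ ≤ ½` (for
matrices: `det∘exp = exp∘tr`, `Literature.Analysis.Matrix.det_exp_eq_exp_trace`; kept as a hypothesis here, discharged at the pin), EVERY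
constituent of the nonlinearity of (1.88) preserves `τ`-free data — indeed the conjugations `R(·)`, the series `g(i ad_Y)` and ALL the BCH
remainders `𝔉₁, 𝔉₂, 𝔉₃` and print's `V = g(i ad_{λ′}) − 1` are `τ`-free IDENTICALLY (no hypothesis on their arguments beyond the radii) —, the
Picard iterates of the Neumann inversion (1.96) stay `τ`-free on the `Ω_j`, and Banach's iteration stays in the closed kernel.

## WHAT IS PROVED (kernel; `𝔸` a nontrivial C⋆-algebra, `τ : 𝔸 →L[ℂ] ℂ` with (T1), (T2) as displayed hypotheses)
* §1 LOCAL: `apply_conjR` (`τ(uYu⁻¹) = τ(Y)`), `apply_ad_pow_succ` (`τ((ad a)ⁿ⁺¹X) = 0`), **`apply_gSer_ad`** (`τ(g(ad_a)X) = τ(X)`: the series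
  (33) term by term), `apply_gAd`, **`apply_W182`** (`τ((1/i)log(e^{−iY}e^{iY+iX})) = τ(X)`, by (T2)), **`apply_F183`**, **`apply_F185`**,
  `apply_frakF1`, `apply_frakF2`, **`apply_frakF3`** (`= 0` identically in the radii of `B8Prop5Reality`).
* §2 GLOBAL: `apply_Vop` (`= 0` identically), `apply_Wsrc` (`= τ(D*A(x)) + τ(E(x))`, hence `0` for `τ`-free datum and defect), `apply_zseq`,
  **`apply_zsol`** (the Neumann solution is `τ`-free on the `Ω_j` — no hypothesis on the letter `R` is needed, `V` kills `τ`).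
* §3 `isClosed_traceFree_and_zero_mem` (the `τ`-free configurations of the space (1.102): closed, contain `0`), `fixedPoint_kLevel_traceFree_of_ball` (the invariance
  transfer on the ¼α₄-ball, verbatim twin of `B8Prop5Reality.fixedPoint_kLevel_selfAdjoint_of_ball`) and
  ★ **`propFive_fixedPoint_kLevel_traceFree`**: in the setting of `B8Prop5ContractionKLevel.propFive_fixedPoint_kLevel` (same windows), if
  `τ(D*A) = 0` on the `Ω_j`, the linearisation defect `Eterm` maps `τ`-free configurations of the ball to `τ`-free values on the `Ω_j`, the
  letter `R` maps `τ`-free-on-Ω data to `τ`-free-on-Ω values and `G′` maps `τ`-free-on-Ω data to `τ`-free configurations, then the fixed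
  point `s` has `τ(λ_s(x)) = 0` at every site.  NO unitarity of `U₀`, NO reality and NO `τ`-freeness of `A` or of the gauge-parameter map
  `gpar` is needed at this level (they enter one storey up, through `D*A` and `Eterm`).

## HONEST SCOPE — what is NOT claimed
(i) Invariance bookkeeping at the level of `B8Prop5ContractionKLevel` only: the thread UP to the sockets (`B8Prop5GaugeParamKLevel` →
`B8Prop5JoinHFP`∕`JoinSectELocalRD` → `SockHFP₀`∕`SockHFP` with a «datum traceless ⇒ λ traceless» clause → `u′ = e^{iλ} ∈ SU(N)` by
`det_exp_eq_exp_trace`, as in `B7Prop2SpecialUnitary.bavg_mem_specialUnitaryUnits`) and the discharge of (T2) for `M_N(ℂ)` are separate modules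
(joint J-SU, layers 2–3).  (ii) (T1)–(T2) are hypotheses on `τ`; the letters' `τ`-compatibility (`hRτ`, `hGτ`, `hEτ`) is hypothesised — for
[4]'s operators (covariant Laplacians, block averages, their inverses: built from parallel transports `Ad(U₀(b))` and limits) it is immediate
at the pin.  (iii) Nothing of Proposition 5 beyond `B8Prop5ContractionKLevel` is claimed; count-neutral; N05 ∕ `stub_PV3A` NOT discharged;
nothing continuum ∕ ℝ⁴ ∕ OS ∕ mass-gap ∕ Clay.  No `sorry`, no `def`, no `… : Prop` fact, no `instance`, no `notation`.  Tree API by name only.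
-/

noncomputable section

open NormedSpace Metric Set Filter Topology
open Complex (I I_ne_zero)
open scoped BigOperators

namespace Literature.MathematicalPhysics.QuantumFieldTheory.Balaban1983to89.B8Prop5TraceFree

open Literature.Analysis.Calculus.ExpDifferential (ad ad_apply gSer gSer_apply_eq_tsum ad_pow_succ_apply gSer_eq_tsum_neg_one_pow
  summable_gSer_term')
open MatrixLog (mlog)
open B7Prop1Explicit (e expUnit val_expUnit)
open B7Eq78Linearization (conjR conjR_apply)
open B7Eq38Remainder (norm_I_smul')
open B8Ineq132 (covDerivFwd covDeriv)
open B8Eq182Proof (W182 gAd F183 F185 frakF1 frakF2 eq182_alg norm_W182_le)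
open B8Eq184Proof (gaugeExp)
open B8Eq188Proof (frakF3)
open B8LambdaSpaceKLevel (wt lamSubK lamOf lamOf_zero fpMapK lamOf_fpMapK norm_fpMapK_le ext_of_lamOf norm_sub_le_iff)
open B8Prop5LocalLipschitz (gAd_eq_gSer_ad norm_eta_conj_le)
open B8Prop5ContractionKLevel (Bd2 Zseq Zsol zseq_zero zseq_succ tendsto_zsol Vop Wsrc Vop_sub norm_Vop_le wt_sq_norm_Wsrc_le PsiP5 Mc Kc
  mWc KWc mWc_nonneg KWc_nonneg eta_mul_le_of_wt_mul_le)
open B8Prop5PsiBounds (psiP5_bd2 psiP5_sub_bd2)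
open B8SectDSource (fixedPoint_mem_of_invariant)

-- `Site` alone could resolve to the torus sites of `Setup.lean`; re-export the `ℤ^d` sites of `B7Prop1Explicit`.
export B7Prop1Explicit (Site)

variable {d : ℕ} {𝔸 : Type*} [CStarAlgebra 𝔸] [Nontrivial 𝔸]

/-! ## §1 Local: every constituent of the nonlinearity of (1.88) preserves `τ`-free data (most of them identically) -/

section Local

variable (τ : 𝔸 →L[ℂ] ℂ)

omit [Nontrivial 𝔸] in
/-- **(T1) ⇒ conjugation is `τ`-invisible**: `τ(R(u)Y) = τ(uYu⁻¹) = τ(Y)`. [cite: Balaban1985RegularSpaces, (1.1) p.76, (1.88) p.91] -/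
theorem apply_conjR (hτ : ∀ x y : 𝔸, τ (x * y) = τ (y * x)) (u : 𝔸ˣ) (Y : 𝔸) : τ (conjR u Y) = τ Y := by
  rw [conjR_apply, hτ, ← mul_assoc, Units.inv_mul, one_mul]

omit [Nontrivial 𝔸] in
/-- `τ((ad a)ⁿ⁺¹X) = 0`: every positive power of `ad_a` produces a commutator. [cite: Balaban1985Averaging, (29) p.22] -/
theorem apply_ad_pow_succ (hτ : ∀ x y : 𝔸, τ (x * y) = τ (y * x)) (a X : 𝔸) (n : ℕ) : τ ((ad ℂ a ^ (n + 1)) X) = 0 := by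
  rw [ad_pow_succ_apply, map_sub, hτ, sub_self]

omit [Nontrivial 𝔸] in
/-- **`τ(g(ad_a)X) = τ(X)`**: the operator series (33) `g(T) = Σ (−1)ⁿTⁿ/(n+1)!` applied to `X` has `τ`-free terms for `n ≥ 1` and the term
`X` for `n = 0`; `τ` is continuous. [cite: Balaban1985Averaging, (32)–(33) p.22] -/
theorem apply_gSer_ad (hτ : ∀ x y : 𝔸, τ (x * y) = τ (y * x)) (a X : 𝔸) : τ (gSer ℂ (ad ℂ a) X) = τ X := by
  -- the applied series (33)
  have happ : HasSum (fun n : ℕ => ((-1 : ℂ) ^ n * ((n + 1).factorial : ℂ)⁻¹) • (ad ℂ a ^ n) X) (gSer ℂ (ad ℂ a) X) := by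
    have hop := (summable_gSer_term' (𝕂 := ℂ) (ad ℂ a)).hasSum
    rw [← gSer_eq_tsum_neg_one_pow] at hop
    have h := (ContinuousLinearMap.apply ℂ 𝔸 X).hasSum hop
    simpa only [ContinuousLinearMap.apply_apply, FunLike.coe_smul, Pi.smul_apply] using h
  have hτs : HasSum (fun n : ℕ => ((-1 : ℂ) ^ n * ((n + 1).factorial : ℂ)⁻¹) • τ ((ad ℂ a ^ n) X)) (τ (gSer ℂ (ad ℂ a) X)) := by
    simpa only [map_smul] using τ.hasSum happ
  have hite : HasSum (fun n : ℕ => if n = 0 then τ X else 0) (τ X) := hasSum_ite_eq 0 (τ X)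
  have hfun : (fun n : ℕ => ((-1 : ℂ) ^ n * ((n + 1).factorial : ℂ)⁻¹) • τ ((ad ℂ a ^ n) X)) =
      fun n => if n = 0 then τ X else 0 := by
    funext n
    cases n with
    | zero =>
      rw [if_pos rfl, pow_zero, pow_zero, one_apply_eq_self, one_mul, zero_add, Nat.factorial_one, Nat.cast_one, inv_one,
        one_smul]
    | succ n => rw [if_neg (Nat.succ_ne_zero n), apply_ad_pow_succ τ hτ a X n, smul_zero]
  rw [hfun] at hτs
  exact hτs.unique hite

omit [Nontrivial 𝔸] in
/-- **`τ(g(i ad_Y)X) = τ(X)`** (p05's `gAd X Y`, `‖Y‖ ≤ 1/12`). [cite: Balaban1985RegularSpaces, (1.82), (1.84) p.90] -/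
theorem apply_gAd (hτ : ∀ x y : 𝔸, τ (x * y) = τ (y * x)) (X : 𝔸) {Y : 𝔸} (hY : ‖Y‖ ≤ 1 / 12) : τ (gAd X Y) = τ X := by
  rw [gAd_eq_gSer_ad X hY]; exact apply_gSer_ad τ hτ _ X

omit [Nontrivial 𝔸] in
/-- **The exponent (1.82)**: `τ(W182 X Y) = τ((1/i) log(e^{−iY}e^{iY+iX})) = τ(X)` for `‖X‖ ≤ 1/12`, `‖Y‖ ≤ 1/24`, by (T2).
[cite: Balaban1985RegularSpaces, (1.82) p.90; Balaban1985Averaging, (28) p.22] -/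
theorem apply_W182 (hlog : ∀ a b : 𝔸, ‖a‖ + ‖b‖ ≤ 1 / 2 → τ (mlog (exp a * exp b)) = τ a + τ b)
    {X Y : 𝔸} (hX : ‖X‖ ≤ 1 / 12) (hY : ‖Y‖ ≤ 1 / 24) : τ (W182 X Y) = τ X := by
  have hr : ‖(-(I • Y) : 𝔸)‖ + ‖I • Y + I • X‖ ≤ 1 / 2 := by
    rw [norm_neg, norm_I_smul']
    have := norm_add_le (I • Y : 𝔸) (I • X)
    rw [norm_I_smul', norm_I_smul'] at this
    linarith
  rw [W182, map_smul, hlog _ _ hr, map_neg, map_add, map_smul, map_smul, neg_add_cancel_left, smul_eq_mul, smul_eq_mul, ← mul_assoc,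
    inv_mul_cancel₀ I_ne_zero, one_mul]

omit [Nontrivial 𝔸] in
/-- **The remainder `F183 = O(|X|²)` of (1.82)–(1.83) is `τ`-free identically** (`F183 = W182 − g(i ad)`, both carrying `τ(X)`).
[cite: Balaban1985RegularSpaces, (1.82)–(1.83) p.90] -/
theorem apply_F183 (hτ : ∀ x y : 𝔸, τ (x * y) = τ (y * x))
    (hlog : ∀ a b : 𝔸, ‖a‖ + ‖b‖ ≤ 1 / 2 → τ (mlog (exp a * exp b)) = τ a + τ b)
    {X Y : 𝔸} (hX : ‖X‖ ≤ 1 / 12) (hY : ‖Y‖ ≤ 1 / 24) : τ (F183 X Y) = 0 := by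
  have hY12 : ‖Y‖ ≤ 1 / 12 := by linarith
  have h := eq182_alg (X := X) (by linarith) hY12
  have hF : F183 X Y = W182 X Y - gAd X Y := by rw [h]; abel
  rw [hF, map_sub, apply_W182 τ hlog hX hY, apply_gAd τ hτ X hY12, sub_self]

/-- **The BCH defect `F185 a X Y` of (1.84)–(1.85) is `τ`-free identically** (`‖a‖ ≤ 1/10`, `‖X‖ ≤ 1/70`, `‖Y‖ ≤ 1/24`): `τ(log(e^{ia}e^{iW})) =
iτ(a) + iτ(W)` by (T2). [cite: Balaban1985RegularSpaces, (1.84)–(1.85) p.90; Balaban1985Averaging, (28), (31) pp.22–23] -/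
theorem apply_F185 (hlog : ∀ a b : 𝔸, ‖a‖ + ‖b‖ ≤ 1 / 2 → τ (mlog (exp a * exp b)) = τ a + τ b)
    {a X Y : 𝔸} (han : ‖a‖ ≤ 1 / 10) (hXn : ‖X‖ ≤ 1 / 70) (hYn : ‖Y‖ ≤ 1 / 24) : τ (F185 a X Y) = 0 := by
  have hWn : ‖W182 X Y‖ ≤ 7 * ‖X‖ := norm_W182_le (by linarith) (by linarith)
  have hr : ‖(I • a : 𝔸)‖ + ‖(I • W182 X Y : 𝔸)‖ ≤ 1 / 2 := by
    rw [norm_I_smul', norm_I_smul']; linarith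
  have hF : F185 a X Y = (I⁻¹ : ℂ) • mlog (exp (I • a) * exp (I • W182 X Y)) - a - W182 X Y := by
    rw [F185, smul_sub, smul_sub, smul_smul, smul_smul, inv_mul_cancel₀ I_ne_zero, one_smul, one_smul]
  rw [hF, map_sub, map_sub, map_smul, hlog _ _ hr, map_smul, map_smul, smul_eq_mul, smul_eq_mul, smul_eq_mul, ← mul_add, ← mul_assoc,
    inv_mul_cancel₀ I_ne_zero, one_mul]
  ring

omit [Nontrivial 𝔸] in
/-- A real scalar passes through `τ`. [folklore] -/
private theorem apply_real_smul (r : ℝ) (x : 𝔸) : τ (r • x) = (r : ℂ) • τ x := by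
  rw [← Complex.coe_smul, map_smul]

omit [Nontrivial 𝔸] in
/-- **`𝔉₁(l, D)` of (1.82)–(1.83) is `τ`-free identically** (`‖l‖ ≤ 1/24`, `η‖D‖ ≤ 1/12`, `η > 0`). [cite: Balaban1985RegularSpaces, (1.83) p.90] -/
theorem apply_frakF1 (hτ : ∀ x y : 𝔸, τ (x * y) = τ (y * x))
    (hlog : ∀ a b : 𝔸, ‖a‖ + ‖b‖ ≤ 1 / 2 → τ (mlog (exp a * exp b)) = τ a + τ b)
    {η : ℝ} (hη : 0 < η) {l D : 𝔸} (hln : ‖l‖ ≤ 1 / 24) (hDn : η * ‖D‖ ≤ 1 / 12) : τ (frakF1 η l D) = 0 := by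
  have hXn : ‖(η • D : 𝔸)‖ ≤ 1 / 12 := by rwa [norm_smul, Real.norm_of_nonneg hη.le]
  rw [frakF1, apply_real_smul, apply_F183 τ hτ hlog hXn hln, smul_zero]

/-- **`𝔉₂(l, D, A_b)` of (1.84)–(1.85) is `τ`-free identically** (`‖l‖ ≤ 1/24`, `η‖D‖ ≤ 1/70`, `η‖A_b‖ ≤ 1/13`). [cite: Balaban1985RegularSpaces, (1.85) p.90] -/
theorem apply_frakF2 (hlog : ∀ a b : 𝔸, ‖a‖ + ‖b‖ ≤ 1 / 2 → τ (mlog (exp a * exp b)) = τ a + τ b)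
    {η : ℝ} (hη : 0 < η) {l D Ab : 𝔸} (hln : ‖l‖ ≤ 1 / 24) (hDn : η * ‖D‖ ≤ 1 / 70) (hAn : η * ‖Ab‖ ≤ 1 / 13) :
    τ (frakF2 η l D Ab) = 0 := by
  have hXn : ‖(η • D : 𝔸)‖ ≤ 1 / 70 := by rwa [norm_smul, Real.norm_of_nonneg hη.le]
  have han : ‖(η • conjR (expUnit (-(I • l))) Ab : 𝔸)‖ ≤ 1 / 10 := by
    have h := norm_eta_conj_le hη.le (by linarith : ‖l‖ ≤ 1 / 12) Ab
    linarith
  rw [frakF2, apply_real_smul, apply_F185 τ hlog han hXn hln, smul_zero]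

/-- **`𝔉₃,μ(a, A)(x)` of (1.88)–(1.89) is `τ`-free identically** in the radii of `B8Prop5Reality.isSelfAdjoint_frakF3` (`‖a(x)‖ ≤ 1/24`,
`η‖D_μa(x)‖, η‖D*_μa(x)‖ ≤ 1/70`, `η‖A_μ(x)‖, η‖R(U₀)A_μ(x − e_μ)‖ ≤ 1/13`) — no hypothesis on `a`, `A`, `U₀` beyond the radii.
[cite: Balaban1985RegularSpaces, (1.88)–(1.89) p.91] -/
theorem apply_frakF3 (hτ : ∀ x y : 𝔸, τ (x * y) = τ (y * x))
    (hlog : ∀ a b : 𝔸, ‖a‖ + ‖b‖ ≤ 1 / 2 → τ (mlog (exp a * exp b)) = τ a + τ b)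
    {η : ℝ} (hη : 0 < η) {U₀ : Site d → Fin d → 𝔸ˣ} {a : Site d → 𝔸} {A : Site d → Fin d → 𝔸} {x : Site d} {μ : Fin d}
    (han : ‖a x‖ ≤ 1 / 24) (hD : η * ‖covDerivFwd η U₀ μ a x‖ ≤ 1 / 70) (hDs : η * ‖covDeriv η U₀ μ a x‖ ≤ 1 / 70)
    (hAn : η * ‖A x μ‖ ≤ 1 / 13) (hYn : η * ‖conjR (U₀ (x - e μ) μ)⁻¹ (A (x - e μ) μ)‖ ≤ 1 / 13) :
    τ (frakF3 η U₀ a A x μ) = 0 := by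
  rw [frakF3, map_neg, map_add, map_add, map_add, apply_frakF1 τ hτ hlog hη han (by linarith), apply_frakF1 τ hτ hlog hη han (by linarith),
    apply_frakF2 τ hlog hη han hDs (by rwa [norm_neg]), apply_frakF2 τ hlog hη han hD hAn]
  simp

end Local

/-! ## §2 `V`, `W`, the Neumann solution `Z` and `Ψ` preserve `τ`-free data on the `Ω_j` -/

section Global

variable (τ : 𝔸 →L[ℂ] ℂ)
variable {L k : ℕ} {η : ℝ} {Ω : ℕ → Set (Site d)} {U₀ : Site d → Fin d → 𝔸ˣ} {A : Site d → Fin d → 𝔸} {DA : Site d → 𝔸}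

omit [Nontrivial 𝔸] in
/-- **Print's `V = g(i ad_{λ′}) − 1` is `τ`-free identically**: `τ((V_a f)(x)) = τ(g(i ad_{a(x)})f(x)) − τ(f(x)) = 0` (`‖a(x)‖ ≤ 1/12`).
[cite: Balaban1985RegularSpaces, (1.94) p.92] -/
theorem apply_Vop (hτ : ∀ x y : 𝔸, τ (x * y) = τ (y * x)) {a : Site d → 𝔸} (f : Site d → 𝔸) {x : Site d} (han : ‖a x‖ ≤ 1 / 12) :
    τ (Vop a f x) = 0 := by
  rw [Vop, map_sub, apply_gAd τ hτ (f x) han, sub_self]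

/-- **`τ(W(x)) = τ(D*A(x)) + τ(E(x))`** in the windows of `wt_sq_norm_Wsrc_le`: the conjugation and `g(i ad)` are `τ`-invisible and the `𝔉₃`-sum is
`τ`-free identically; hence `W` is `τ`-free on the `Ω_j` for a `τ`-free datum `D*A` and defect `E`. [cite: Balaban1985RegularSpaces, (1.88) p.91, (1.93)–(1.95) p.92] -/
theorem apply_Wsrc (hτ : ∀ x y : 𝔸, τ (x * y) = τ (y * x))
    (hlog : ∀ a b : 𝔸, ‖a‖ + ‖b‖ ≤ 1 / 2 → τ (mlog (exp a * exp b)) = τ a + τ b)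
    (hL : 1 ≤ L) (hη : 0 < η) {a E : Site d → 𝔸} {j : ℕ} {x : Site d}
    {b₁ cA : ℝ} (hb : b₁ ≤ 1 / 140) (hc : cA ≤ 1 / 13) (han : ‖a x‖ ≤ 1 / 24)
    (hD : ∀ μ, wt L η j * ‖covDerivFwd η U₀ μ a x‖ ≤ b₁ ∧ wt L η j * ‖covDeriv η U₀ μ a x‖ ≤ b₁)
    (hAw : ∀ μ, wt L η j * ‖A x μ‖ ≤ cA ∧ wt L η j * ‖conjR (U₀ (x - e μ) μ)⁻¹ (A (x - e μ) μ)‖ ≤ cA) :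
    τ (Wsrc η U₀ A DA a E x) = τ (DA x) + τ (E x) := by
  rw [Wsrc, map_add, map_add, apply_conjR τ hτ, apply_gAd τ hτ (E x) (by linarith), map_sum]
  rw [Finset.sum_eq_zero fun μ _ => ?_, add_zero]
  exact apply_frakF3 τ hτ hlog hη han
    ((eta_mul_le_of_wt_mul_le hL hη j (norm_nonneg _) (hD μ).1).trans (by linarith))
    ((eta_mul_le_of_wt_mul_le hL hη j (norm_nonneg _) (hD μ).2).trans (by linarith))
    ((eta_mul_le_of_wt_mul_le hL hη j (norm_nonneg _) (hAw μ).1).trans hc)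
    ((eta_mul_le_of_wt_mul_le hL hη j (norm_nonneg _) (hAw μ).2).trans hc)

variable {W : Site d → 𝔸} {V R : (Site d → 𝔸) → (Site d → 𝔸)}

omit [Nontrivial 𝔸] in
/-- **The Picard iterates of the Neumann inversion stay `τ`-free on the `Ω_j`** when `W` is `τ`-free there and `V` is `τ`-free at Ω-sites —
NO hypothesis on the letter `R`. [cite: Balaban1985RegularSpaces, (1.96) p.92] -/
theorem apply_zseq (hW : ∀ j, j ≤ k → ∀ x ∈ Ω j, τ (W x) = 0) (hV : ∀ f : Site d → 𝔸, ∀ j, j ≤ k → ∀ x ∈ Ω j, τ (V f x) = 0) :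
    ∀ n, ∀ j, j ≤ k → ∀ x ∈ Ω j, τ (Zseq W V R n x) = 0 := by
  intro n
  induction n with
  | zero => intro j hj x hx; rw [zseq_zero]; exact hW j hj x hx
  | succ n _ =>
    intro j hj x hx
    rw [zseq_succ, map_sub, hW j hj x hx, hV _ j hj x hx, sub_zero]

omit [Nontrivial 𝔸] in
/-- **`Z = (I + VR)⁻¹W` is `τ`-free on the `Ω_j`**: there it is the limit of the `τ`-free iterates (`tendsto_zsol`) and `ker τ` is closed.
[cite: Balaban1985RegularSpaces, (1.96) p.92] -/
theorem apply_zsol (hL : 1 ≤ L) (hη : 0 < η) {cV BR mW : ℝ}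
    (hVsub : ∀ f g : Site d → 𝔸, ∀ j, j ≤ k → ∀ x ∈ Ω j, V f x - V g x = V (f - g) x)
    (hVbd : ∀ f : Site d → 𝔸, ∀ j, j ≤ k → ∀ x ∈ Ω j, ‖V f x‖ ≤ cV * ‖f x‖)
    (hRsub : ∀ f g : Site d → 𝔸, R (f - g) = R f - R g)
    (hRbd : ∀ (f : Site d → 𝔸) (m : ℝ), 0 ≤ m → Bd2 L η k Ω f m → Bd2 L η k Ω (R f) (BR * m))
    (hWb : Bd2 L η k Ω W mW) (hcV : 0 ≤ cV) (hBR : 0 ≤ BR) (hmW : 0 ≤ mW) (hθ : cV * BR ≤ 1 / 2)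
    (hW : ∀ j, j ≤ k → ∀ x ∈ Ω j, τ (W x) = 0) (hV : ∀ f : Site d → 𝔸, ∀ j, j ≤ k → ∀ x ∈ Ω j, τ (V f x) = 0)
    {j : ℕ} (hj : j ≤ k) {x : Site d} (hx : x ∈ Ω j) : τ (Zsol W V R x) = 0 := by
  have ht := tendsto_zsol hL hη hVsub hVbd hRsub hRbd hWb hcV hBR hmW hθ hj hx
  have hcl : IsClosed {y : 𝔸 | τ y = 0} := isClosed_eq τ.continuous continuous_const
  exact hcl.mem_of_tendsto ht (Eventually.of_forall fun n => apply_zseq τ hW hV n j hj x hx)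

end Global

/-! ## §3 The fixed point of (1.100) is a `τ`-FREE configuration -/

section FixedPoint

variable (τ : 𝔸 →L[ℂ] ℂ)
variable {L k : ℕ} {η : ℝ} {Ω : ℕ → Set (Site d)} {Eb : ℕ → Set (Site d × Fin d)} {U₀ : Site d → Fin d → 𝔸ˣ}
  {A : Site d → Fin d → 𝔸} {DA : Site d → 𝔸}

omit [Nontrivial 𝔸] in
/-- The `τ`-FREE configurations of the space (1.102) — those `s` whose λ-component lies in `ker τ` at every site (print: «with values in the
algebra 𝔤», (1.17) p. 78) — form a CLOSED subset containing `0` (evaluation and `τ` are continuous). [cite: Balaban1985RegularSpaces, (1.17) p.78, p.93 (after (1.102))] -/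
theorem isClosed_traceFree_and_zero_mem (η' : ℝ) (U₀' : Site d → Fin d → 𝔸ˣ) (L' k' : ℕ) (Eb' : ℕ → Set (Site d × Fin d)) :
    IsClosed {s : lamSubK η' U₀' L' k' Eb' | ∀ x, τ (lamOf s x) = 0} ∧
      (0 : lamSubK η' U₀' L' k' Eb') ∈ {s : lamSubK η' U₀' L' k' Eb' | ∀ x, τ (lamOf s x) = 0} := by
  refine ⟨?_, fun x => by rw [lamOf_zero, Pi.zero_apply, map_zero]⟩
  have : {s : lamSubK η' U₀' L' k' Eb' | ∀ x, τ (lamOf s x) = 0} =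
      ⋂ x : Site d, {s : lamSubK η' U₀' L' k' Eb' | τ (lamOf s x) = 0} := by
    ext s; simp
  rw [this]
  refine isClosed_iInter fun x => ?_
  have hev : Continuous fun s : lamSubK η' U₀' L' k' Eb' => lamOf s x :=
    (ContinuousEvalConst.continuous_eval_const (Sum.inl x)).comp continuous_subtype_val
  exact isClosed_eq (τ.continuous.comp hev) continuous_const

omit [Nontrivial 𝔸] in
/-- **The invariance transfer on the ball** (twin of `B8Prop5Reality.fixedPoint_kLevel_selfAdjoint_of_ball`): if `G′ ∘ Ψ` maps the `τ`-free
elements of the closed ¼α₄-ball to `τ`-free configurations, the fixed point of `B8LambdaSpaceKLevel.fixedPoint_kLevel` is `τ`-free (Banach's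
iteration from `0` stays in the closed kernel; `B8SectDSource.fixedPoint_mem_of_invariant`). [cite: Balaban1985RegularSpaces, p.93 (after (1.102)), (1.100) p.93] -/
theorem fixedPoint_kLevel_traceFree_of_ball (hη : 0 ≤ η) (Ω : ℕ → Set (Site d)) (Gp Ψ : (Site d → 𝔸) → (Site d → 𝔸))
    {α₄ B₀' M K : ℝ} (hα₄ : 0 ≤ α₄) (hB : 0 ≤ B₀') (hM : 0 ≤ M) (hK : 0 ≤ K)
    (hG : ∀ (f : Site d → 𝔸) (m : ℝ), 0 ≤ m → (∀ j, j ≤ k → ∀ x ∈ Ω j, wt L η j ^ 2 * ‖f x‖ ≤ m) →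
      (∀ x, ‖Gp f x‖ ≤ B₀' * m) ∧ ∀ j, j ≤ k → ∀ p ∈ Eb j, wt L η j * ‖covDerivFwd η U₀ p.2 (Gp f) p.1‖ ≤ B₀' * m)
    (hGsub : ∀ f g : Site d → 𝔸, Gp (f - g) = Gp f - Gp g)
    (hΨ0 : ∀ s : lamSubK η U₀ L k Eb, ‖s‖ ≤ α₄ / 4 → ∀ j, j ≤ k → ∀ x ∈ Ω j, wt L η j ^ 2 * ‖Ψ (lamOf s) x‖ ≤ M)
    (hΨ1 : ∀ s t : lamSubK η U₀ L k Eb, ‖s‖ ≤ α₄ / 4 → ‖t‖ ≤ α₄ / 4 →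
      ∀ j, j ≤ k → ∀ x ∈ Ω j, wt L η j ^ 2 * ‖Ψ (lamOf s) x - Ψ (lamOf t) x‖ ≤ K * ‖s - t‖)
    (h103 : B₀' * M ≤ α₄ / 4) (h106 : B₀' * K ≤ 1 / 2)
    (htf : ∀ s : lamSubK η U₀ L k Eb, ‖s‖ ≤ α₄ / 4 → (∀ x, τ (lamOf s x) = 0) → ∀ x, τ (Gp (Ψ (lamOf s)) x) = 0)
    {s : lamSubK η U₀ L k Eb} (hs : ‖s‖ ≤ α₄ / 4) (hfix : lamOf s = Gp (Ψ (lamOf s))) :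
    ∀ x, τ (lamOf s x) = 0 := by
  set T := fpMapK hη Ω Gp Ψ α₄ B₀' M hG hM hΨ0 with hT
  have hmaps : ∀ s : lamSubK η U₀ L k Eb, ‖s‖ ≤ α₄ / 4 → ‖T s‖ ≤ α₄ / 4 := fun s hs =>
    (norm_fpMapK_le hη Ω Gp Ψ α₄ B₀' M hG hM hΨ0 hs).trans h103
  have hlip : ∀ s t : lamSubK η U₀ L k Eb, ‖s‖ ≤ α₄ / 4 → ‖t‖ ≤ α₄ / 4 → ‖T s - T t‖ ≤ B₀' * K * ‖s - t‖ := by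
    intro s t hs ht
    have hm : 0 ≤ K * ‖s - t‖ := by positivity
    have hdiff : ∀ j, j ≤ k → ∀ x ∈ Ω j, wt L η j ^ 2 * ‖(Ψ (lamOf s) - Ψ (lamOf t)) x‖ ≤ K * ‖s - t‖ := fun j hj x hx => by
      simpa only [Pi.sub_apply] using hΨ1 s t hs ht j hj x hx
    obtain ⟨h0, h1⟩ := hG (Ψ (lamOf s) - Ψ (lamOf t)) (K * ‖s - t‖) hm hdiff
    rw [show B₀' * K * ‖s - t‖ = B₀' * (K * ‖s - t‖) by ring]
    refine (norm_sub_le_iff hη (T s) (T t) (by positivity)).2 ⟨fun x => ?_, fun j hj p hp => ?_⟩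
    · rw [hT, lamOf_fpMapK hη Ω Gp Ψ α₄ B₀' M hG hM hΨ0 hs, lamOf_fpMapK hη Ω Gp Ψ α₄ B₀' M hG hM hΨ0 ht, ← Pi.sub_apply,
        ← hGsub]
      exact h0 x
    · rw [hT, lamOf_fpMapK hη Ω Gp Ψ α₄ B₀' M hG hM hΨ0 hs, lamOf_fpMapK hη Ω Gp Ψ α₄ B₀' M hG hM hΨ0 ht, ← hGsub]
      exact h1 j hj p hp
  have hκ1 : B₀' * K < 1 := by linarith
  have hinv : ∀ t ∈ {s : lamSubK η U₀ L k Eb | ∀ x, τ (lamOf s x) = 0}, ‖t‖ ≤ α₄ / 4 →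
      T t ∈ {s : lamSubK η U₀ L k Eb | ∀ x, τ (lamOf s x) = 0} := by
    intro t ht htn x
    rw [hT, lamOf_fpMapK hη Ω Gp Ψ α₄ B₀' M hG hM hΨ0 htn]
    exact htf t htn ht x
  have hTfix : T s = s := by
    apply ext_of_lamOf
    rw [hT, lamOf_fpMapK hη Ω Gp Ψ α₄ B₀' M hG hM hΨ0 hs]
    exact hfix.symm
  obtain ⟨hcl, h0⟩ := isClosed_traceFree_and_zero_mem τ η U₀ L k Eb
  exact fixedPoint_mem_of_invariant T (by positivity) (by positivity) hκ1 hmaps hlip _ hcl h0 hinv hs hTfix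

/-- ★ **THE FIXED POINT OF (1.100) IS `τ`-FREE** (print: the gauge parameter is `𝔤`-valued; for `𝔸 = M_N(ℂ)`, `τ = tr` this is «λ traceless»,
so `e^{iλ} ∈ SU(N)`): in the setting of `B8Prop5ContractionKLevel.propFive_fixedPoint_kLevel` (same windows), for a continuous functional `τ`
with (T1) `τ(xy) = τ(yx)` and (T2) `τ(log(eᵃeᵇ)) = τ(a) + τ(b)` (`‖a‖ + ‖b‖ ≤ ½`), assume the datum `D*A` is `τ`-free on the `Ω_j`, the defect
`Eterm` maps `τ`-free configurations of the ball to `τ`-free values on the `Ω_j`, the letter `R` maps `τ`-free-on-Ω data to `τ`-free-on-Ω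
values and `G′` maps `τ`-free-on-Ω data to `τ`-free configurations; then the fixed point `s` has `τ(λ_s(x)) = 0` at every site.  (No
unitarity of `U₀`, no reality, no condition on `A` or `gpar` beyond the radii.) [cite: Balaban1985RegularSpaces, (1.17) p.78, p.93 (after (1.102)), (1.100) p.93, (1.107) p.94] -/
theorem propFive_fixedPoint_kLevel_traceFree (hτ : ∀ x y : 𝔸, τ (x * y) = τ (y * x))
    (hlog : ∀ a b : 𝔸, ‖a‖ + ‖b‖ ≤ 1 / 2 → τ (mlog (exp a * exp b)) = τ a + τ b)
    (hL : 1 ≤ L) (hη : 0 < η)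
    (Gp R gpar Eterm : (Site d → 𝔸) → (Site d → 𝔸))
    {α₄ BG BR a₁ b₁ cA cDA mE KE ℓ₀ ℓ₁ : ℝ}
    (hα₄ : 0 ≤ α₄) (hBG : 0 ≤ BG) (hBR : 0 ≤ BR) (ha₁ : 0 ≤ a₁) (ha₁' : a₁ ≤ 1 / 24) (hb₁ : 0 < b₁) (hb₁' : b₁ ≤ 1 / 140)
    (hcA : 0 ≤ cA) (hcA' : cA ≤ 1 / 13) (hcDA : 0 ≤ cDA) (hmE : 0 ≤ mE) (hKE : 0 ≤ KE) (hℓ₀ : 0 ≤ ℓ₀) (hℓ₁ : 0 ≤ ℓ₁)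
    (hθ : 10 * a₁ * BR ≤ 1 / 2)
    (hG : ∀ (f : Site d → 𝔸) (m : ℝ), 0 ≤ m → Bd2 L η k Ω f m →
      (∀ x, ‖Gp f x‖ ≤ BG * m) ∧ ∀ j, j ≤ k → ∀ p ∈ Eb j, wt L η j * ‖covDerivFwd η U₀ p.2 (Gp f) p.1‖ ≤ BG * m)
    (hGsub : ∀ f g : Site d → 𝔸, Gp (f - g) = Gp f - Gp g)
    (hRsub : ∀ f g : Site d → 𝔸, R (f - g) = R f - R g)
    (hRbd : ∀ (f : Site d → 𝔸) (m : ℝ), 0 ≤ m → Bd2 L η k Ω f m → Bd2 L η k Ω (R f) (BR * m))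
    (hg0 : ∀ s : lamSubK η U₀ L k Eb, ‖s‖ ≤ α₄ / 4 → ∀ j, j ≤ k → ∀ x ∈ Ω j, ‖gpar (lamOf s) x‖ ≤ a₁)
    (hg1 : ∀ s : lamSubK η U₀ L k Eb, ‖s‖ ≤ α₄ / 4 → ∀ j, j ≤ k → ∀ x ∈ Ω j, ∀ μ : Fin d,
      wt L η j * ‖covDerivFwd η U₀ μ (gpar (lamOf s)) x‖ ≤ b₁ ∧ wt L η j * ‖covDeriv η U₀ μ (gpar (lamOf s)) x‖ ≤ b₁)
    (hgL : ∀ s t : lamSubK η U₀ L k Eb, ‖s‖ ≤ α₄ / 4 → ‖t‖ ≤ α₄ / 4 → ∀ j, j ≤ k → ∀ x ∈ Ω j,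
      ‖gpar (lamOf s) x - gpar (lamOf t) x‖ ≤ ℓ₀ * ‖s - t‖ ∧ ∀ μ : Fin d,
        wt L η j * ‖covDerivFwd η U₀ μ (gpar (lamOf s) - gpar (lamOf t)) x‖ ≤ ℓ₁ * ‖s - t‖ ∧
        wt L η j * ‖covDeriv η U₀ μ (gpar (lamOf s) - gpar (lamOf t)) x‖ ≤ ℓ₁ * ‖s - t‖)
    (hE0 : ∀ s : lamSubK η U₀ L k Eb, ‖s‖ ≤ α₄ / 4 → Bd2 L η k Ω (Eterm (lamOf s)) mE)
    (hEL : ∀ s t : lamSubK η U₀ L k Eb, ‖s‖ ≤ α₄ / 4 → ‖t‖ ≤ α₄ / 4 → Bd2 L η k Ω (Eterm (lamOf s) - Eterm (lamOf t)) (KE * ‖s - t‖))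
    (hDA : Bd2 L η k Ω DA cDA)
    (hA : ∀ j, j ≤ k → ∀ x ∈ Ω j, ∀ μ : Fin d,
      wt L η j * ‖A x μ‖ ≤ cA ∧ wt L η j * ‖conjR (U₀ (x - e μ) μ)⁻¹ (A (x - e μ) μ)‖ ≤ cA)
    (h103 : BG * Mc d BR b₁ cA mE cDA ≤ α₄ / 4) (h106 : BG * Kc d BR b₁ cA mE cDA KE ℓ₀ ℓ₁ ≤ 1 / 2)
    -- `τ`-freeness of the datum, the defect and the letters
    (hDAτ : ∀ j, j ≤ k → ∀ x ∈ Ω j, τ (DA x) = 0)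
    (hEτ : ∀ s : lamSubK η U₀ L k Eb, ‖s‖ ≤ α₄ / 4 → (∀ x, τ (lamOf s x) = 0) → ∀ j, j ≤ k → ∀ x ∈ Ω j, τ (Eterm (lamOf s) x) = 0)
    (hRτ : ∀ f : Site d → 𝔸, (∀ j, j ≤ k → ∀ x ∈ Ω j, τ (f x) = 0) → ∀ j, j ≤ k → ∀ x ∈ Ω j, τ (R f x) = 0)
    (hGτ : ∀ f : Site d → 𝔸, (∀ j, j ≤ k → ∀ x ∈ Ω j, τ (f x) = 0) → ∀ x, τ (Gp f x) = 0)
    {s : lamSubK η U₀ L k Eb} (hs : ‖s‖ ≤ α₄ / 4) (hfix : lamOf s = Gp (PsiP5 η U₀ A DA R gpar Eterm (lamOf s))) :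
    ∀ x, τ (lamOf s x) = 0 := by
  -- the invariance on the ball: every constituent preserves `τ`-free data
  have hmW : 0 ≤ mWc d b₁ cA mE cDA := mWc_nonneg hb₁.le hcA hmE hcDA
  have hcV : 0 ≤ 10 * a₁ := by positivity
  have ha12 : a₁ ≤ 1 / 12 := by linarith
  have hb70 : b₁ ≤ 1 / 70 := by linarith
  have hcA12 : cA ≤ 1 / 12 := by linarith
  have htf : ∀ t : lamSubK η U₀ L k Eb, ‖t‖ ≤ α₄ / 4 → (∀ x, τ (lamOf t x) = 0) →
      ∀ x, τ (Gp (PsiP5 η U₀ A DA R gpar Eterm (lamOf t)) x) = 0 := by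
    intro t ht htf0
    have hVsub : ∀ f g : Site d → 𝔸, ∀ j, j ≤ k → ∀ x ∈ Ω j,
        Vop (gpar (lamOf t)) f x - Vop (gpar (lamOf t)) g x = Vop (gpar (lamOf t)) (f - g) x :=
      fun f g j hj x hx => Vop_sub f g ((hg0 t ht j hj x hx).trans ha12)
    have hVbd : ∀ f : Site d → 𝔸, ∀ j, j ≤ k → ∀ x ∈ Ω j, ‖Vop (gpar (lamOf t)) f x‖ ≤ 10 * a₁ * ‖f x‖ :=
      fun f j hj x hx => norm_Vop_le f (hg0 t ht j hj x hx) ha12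
    have hW : Bd2 L η k Ω (Wsrc η U₀ A DA (gpar (lamOf t)) (Eterm (lamOf t))) (mWc d b₁ cA mE cDA) :=
      fun j hj x hx => wt_sq_norm_Wsrc_le hL hη hb70 hcA hcA12 ((hg0 t ht j hj x hx).trans ha12) (hg1 t ht j hj x hx) (hA j hj x hx)
        (hE0 t ht j hj x hx) (hDA j hj x hx)
    have hWτ : ∀ j, j ≤ k → ∀ x ∈ Ω j, τ (Wsrc η U₀ A DA (gpar (lamOf t)) (Eterm (lamOf t)) x) = 0 := by
      intro j hj x hx
      rw [apply_Wsrc τ hτ hlog hL hη hb₁' hcA' ((hg0 t ht j hj x hx).trans ha₁') (hg1 t ht j hj x hx) (hA j hj x hx),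
        hDAτ j hj x hx, hEτ t ht htf0 j hj x hx, add_zero]
    have hVτ : ∀ f : Site d → 𝔸, ∀ j, j ≤ k → ∀ x ∈ Ω j, τ (Vop (gpar (lamOf t)) f x) = 0 :=
      fun f j hj x hx => apply_Vop τ hτ f ((hg0 t ht j hj x hx).trans ha12)
    have hZτ : ∀ j, j ≤ k → ∀ x ∈ Ω j,
        τ (Zsol (Wsrc η U₀ A DA (gpar (lamOf t)) (Eterm (lamOf t))) (Vop (gpar (lamOf t))) R x) = 0 :=
      fun j hj x hx => apply_zsol τ hL hη hVsub hVbd hRsub hRbd hW hcV hBR hmW hθ hWτ hVτ hj hx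
    refine hGτ _ (hRτ _ fun j hj x hx => ?_)
    show τ (-Zsol (Wsrc η U₀ A DA (gpar (lamOf t)) (Eterm (lamOf t))) (Vop (gpar (lamOf t))) R x) = 0
    rw [map_neg, hZτ j hj x hx, neg_zero]
  have hM0 : 0 ≤ Mc d BR b₁ cA mE cDA := by unfold Mc; positivity
  have hKW : 0 ≤ KWc d b₁ cA mE cDA KE ℓ₀ ℓ₁ := KWc_nonneg hb₁.le hcA hmE hcDA hKE hℓ₀ hℓ₁
  have hK0 : 0 ≤ Kc d BR b₁ cA mE cDA KE ℓ₀ ℓ₁ := by unfold Kc; positivity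
  exact fixedPoint_kLevel_traceFree_of_ball τ hη.le Ω Gp (PsiP5 η U₀ A DA R gpar Eterm) hα₄ hBG hM0 hK0
    (fun f m hm hf => hG f m hm hf) hGsub
    (fun t ht => psiP5_bd2 (Ω := Ω) (Eb := Eb) hL hη R gpar Eterm hBR ha₁ ha₁' hb₁ hb₁' hcA hcA' hcDA hmE hθ hRsub hRbd hg0 hg1 hE0
      hDA hA t ht)
    (fun t₁ t₂ ht₁ ht₂ j hj x hx => by
      simpa only [Pi.sub_apply] using psiP5_sub_bd2 (Ω := Ω) (Eb := Eb) hL hη R gpar Eterm hBR ha₁ ha₁' hb₁ hb₁' hcA hcA' hcDA hmE hKE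
        hℓ₀ hℓ₁ hθ hRsub hRbd hg0 hg1 hgL hE0 hEL hDA hA t₁ t₂ ht₁ ht₂ j hj x hx)
    h103 h106 htf hs hfix

end FixedPoint

#print axioms apply_gSer_ad
#print axioms apply_frakF3
#print axioms propFive_fixedPoint_kLevel_traceFree

end Literature.MathematicalPhysics.QuantumFieldTheory.Balaban1983to89.B8Prop5TraceFree

end
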